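import Summits.ValiantsHypothesis.ValiantsHypothesis.Theorems.KPlusLogSqLawTropicalBStaircaseDesign
import Summits.ValiantsHypothesis.ValiantsHypothesis.Theorems.KPlusLogSqLawTropicalBWalkGusfield

/-!
# Route `KPlusLogSqLaw`, crux `TropicalB` — WALK SYSTEMS are quasi-polynomial: Gusfield's bound in the cell's walk currency

HONEST FRAMING.  Helper file (seat val-sym-trop-p1 g4, cell `pub-symmetroid`, 2026-08-27) toward the registered stubs of
`Cruxes/TropicalB/Lines/birth.lean` (crux `TropicalB`, item `stmt-ValiantsHypothesis-19771`).  The tree's construction bridge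
`WalkDesign.le_of_walkSystem` (`…TropicalBStaircaseDesign`) turns a WALK SYSTEM — a layered graph `g : List (WLayer V K)` with a
start vertex `v₀`, strictly increasing integer slopes `lam₀ < ⋯ < lam_N` and dedicated walks `w_j` that are the unique cheapest
walk at `lam_j` with margin `1` — into the census inequality `TropRootLawAt ((T+1)·|V|) K B → N ≤ B`; this is how the staircase
refutes every uniform exponent law.  Here the SAME hypotheses are bounded from above by Gusfield's halving bound
(`LayeredGraph.chainBound_walkFam_clog`, companion file):

  `walkSystem_succ_le :  N + 1 ≤ |V| · (2|V|)^⌈log₂ T⌉`   (`T = g.length` layers; consecutive dedicated walks distinct).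

So walk systems are quasi-polynomial in their size (`|V|^{O(log T)}`), and a walk system of BOUNDED width `|V| = w` has at
most `w·(2w)^⌈log₂ T⌉ = O(T^{log₂ 2w})` dedicated walks: on `m = (T+1)·w` nodes, `O(m²)` at width `2`, `O(m^{2.59})` at width
`3`, `O(m³)` at width `4`.  In particular a CUBIC-in-`m` family for the `K = 4` growth fork cannot come through
`le_of_walkSystem` from layered graphs of width `≤ 3` (the seat's K4-FORK-NOTE question «width 2, 3, …: unknown»), whatever the
number of classes.  KNOWN MATHEMATICS (Gusfield 1980) in the tree's vocabulary; nothing bounds `TropicalB` in its window, and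
nothing is asserted about `WeakLifting`, `MatrixDescartes` (`stmt-ValiantsHypothesis-18050`) or `VP ≠ VNP`.
-/

set_option linter.dupNamespace false
set_option autoImplicit false

namespace Summit.ValiantsHypothesis.ValiantsHypothesis.Theorems.KPlusLogSqLaw.WalkDesign

open Summit.ValiantsHypothesis.ValiantsHypothesis.Theorems.SymmetroidDescartes.DPR
open Summit.ValiantsHypothesis.ValiantsHypothesis.Theorems.KPlusLogSqLaw.ParamLines
open Summit.ValiantsHypothesis.ValiantsHypothesis.Theorems.KPlusLogSqLaw.LayeredGraph
open scoped BigOperators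
open Finset

variable {V : Type*} [Fintype V] {K : ℕ} (d : Fin K → ℕ)

/-- The layered graph of width `|V|` underlying a list of weighted layers `g`, vertices numbered by `Fintype.equivFin V`:
the arc `(t, x) → (t+1, y)` is present iff layer `t` of `g` has the edge, with intercept `e.a` and slope `−d(e.cls)` (so that
`icpt + slope · lam` is the tree's tropical walk cost `Σ (a − lam·d cls)`). [definition of the cell] -/
noncomputable def toLayered (g : List (WLayer V K)) : LayeredGraph (Fintype.card V) where
  adj t x y := ∃ h : t < g.length, (g.get ⟨t, h⟩ ((Fintype.equivFin V).symm x) ((Fintype.equivFin V).symm y)).isSome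
  wa t x y := if h : t < g.length then
      (match g.get ⟨t, h⟩ ((Fintype.equivFin V).symm x) ((Fintype.equivFin V).symm y) with
        | some e => (e.a : ℝ) | none => 0) else 0
  wb t x y := if h : t < g.length then
      (match g.get ⟨t, h⟩ ((Fintype.equivFin V).symm x) ((Fintype.equivFin V).symm y) with
        | some e => -((d e.cls : ℕ) : ℝ) | none => 0) else 0

/-- A vertex sequence through present edges, read as a walk of the layered graph (vertices numbered). [folklore] -/
noncomputable def toLWalk (g : List (WLayer V K)) (y : Fin (g.length + 1) → V)
    (hy : ∀ s : Fin g.length, (edgeAt g.get y s).isSome) : (toLayered d g).LWalk 0 g.length where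
  f i := Fintype.equivFin V (y i)
  step i h := by
    simp only [toLayered, Nat.zero_add, Equiv.symm_apply_apply]
    exact ⟨h, hy ⟨i, h⟩⟩

/-- the vertex sequence of a walk of the numbered layered graph. [folklore] -/
noncomputable def seqOf (g : List (WLayer V K)) (p : (toLayered d g).LWalk 0 g.length) : Fin (g.length + 1) → V :=
  fun i => (Fintype.equivFin V).symm (p.f i)

/-- a walk of the numbered layered graph follows present edges. [folklore] -/
theorem edgeAt_seqOf_isSome (g : List (WLayer V K)) (p : (toLayered d g).LWalk 0 g.length) (s : Fin g.length) :
    (edgeAt g.get (seqOf d g p) s).isSome := by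
  obtain ⟨_, h⟩ := p.step s s.2
  simp only [zero_add] at h
  exact h

/-- **Cost identity.**  The tree's `Fin`-indexed tropical cost of the vertex sequence of a walk is its line `icpt + slope·lam`
evaluated in `ℝ`. [folklore] -/
theorem walkCostFin_seqOf (g : List (WLayer V K)) (p : (toLayered d g).LWalk 0 g.length) (lam : ℤ) :
    ((walkCostFin d g.get lam (seqOf d g p) : ℤ) : ℝ) = p.icpt + p.slope * lam := by
  unfold walkCostFin LayeredGraph.LWalk.icpt LayeredGraph.LWalk.slope
  rw [Finset.sum_mul, ← Finset.sum_add_distrib]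
  push_cast
  refine Finset.sum_congr rfl fun s _ => ?_
  obtain ⟨e, he⟩ := Option.isSome_iff_exists.mp (edgeAt_seqOf_isSome d g p s)
  have he' : g.get ⟨s, s.2⟩ ((Fintype.equivFin V).symm (p.f ⟨s, by omega⟩))
      ((Fintype.equivFin V).symm (p.f ⟨s + 1, by omega⟩)) = some e := he
  rw [he]
  simp only [toLayered, zero_add, dif_pos s.2, he']
  push_cast
  ring

/-- **WALK SYSTEMS ARE QUASI-POLYNOMIAL (Gusfield's bound in walk currency).**  Under the hypotheses of `le_of_walkSystem` minus
the signs (dedicated walks `w_j` uniquely cheapest with margin `1` at strictly increasing integer slopes `lam_j`, consecutive ones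
distinct), `N + 1 ≤ |V| · (2|V|)^⌈log₂ T⌉` with `T = g.length`: group the dedicated walks by their end vertex; each group is a
chain of cheapest walks between two fixed vertices of the width-`|V|` layered graph (`LayeredGraph.chainBound_walkFam_clog`).
[cite: Gusfield1980, n^{O(log n)} bound for parametric shortest paths (via GajjarRadhakrishnan2019 p. 2); folklore form] -/
theorem walkSystem_succ_le [DecidableEq V] (g : List (WLayer V K)) (v₀ : V) {N : ℕ}
    (lam : Fin (N + 1) → ℤ) (hlam : StrictMono lam) (wstar : Fin (N + 1) → List V) (c : Fin (N + 1) → ℤ)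
    (hcost : ∀ j, walkCost d (lam j) g v₀ (wstar j) = ((c j : ℤ) : WithTop ℤ))
    (hmarg : ∀ j (w : List V), w ≠ wstar j → ((c j + 1 : ℤ) : WithTop ℤ) ≤ walkCost d (lam j) g v₀ w)
    (hne : ∀ j : Fin N, wstar j.castSucc ≠ wstar j.succ) :
    N + 1 ≤ Fintype.card V * (2 * Fintype.card V) ^ Nat.clog 2 g.length := by
  classical
  set G := toLayered d g with hG
  -- vertex sequences of the dedicated walks, as walks of `G`
  have hnt : ∀ j, walkCost d (lam j) g v₀ (wstar j) ≠ ⊤ := fun j => by rw [hcost]; exact WithTop.coe_ne_top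
  choose y hy0 hys hyw using fun j => exists_walk_of_walkCost_ne_top d (lam j) g v₀ (wstar j) (hnt j)
  let P : Fin (N + 1) → G.LWalk 0 g.length := fun j => toLWalk d g (y j) (hys j)
  have hseqP : ∀ j, seqOf d g (P j) = y j := by
    intro j; funext i; simp [seqOf, P, toLWalk]
  -- the cost of `P j` at `lam j` is `c j`
  have hcostP : ∀ j, (P j).icpt + (P j).slope * lam j = c j := by
    intro j
    rw [← walkCostFin_seqOf d g (P j) (lam j), hseqP]
    have h1 := walkCost_ofFn d (lam j) g (y j) (hys j)
    rw [hy0 j, hyw j, hcost j] at h1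
    exact_mod_cast (WithTop.coe_eq_coe.mp h1).symm
  -- every walk of `G` with the same start costs at least `c j`, and at least `c j + 1` unless it is `P j`
  have hmin : ∀ j (q : G.LWalk 0 g.length), q.src = (P j).src → (P j).icpt + (P j).slope * lam j ≤ q.icpt + q.slope * lam j := by
    intro j q hq
    rw [hcostP, ← walkCostFin_seqOf d g q (lam j)]
    have hq0 : seqOf d g q 0 = v₀ := by
      have h0 : q.f ⟨0, by omega⟩ = Fintype.equivFin V (y j ⟨0, by omega⟩) := hq
      show (Fintype.equivFin V).symm (q.f ⟨0, by omega⟩) = v₀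
      rw [h0, Equiv.symm_apply_apply]
      exact hy0 j
    have h1 := walkCost_ofFn d (lam j) g (seqOf d g q) (edgeAt_seqOf_isSome d g q)
    rw [hq0] at h1
    by_cases hw : (List.ofFn fun s : Fin g.length => seqOf d g q s.succ) = wstar j
    · rw [hw, hcost j] at h1
      exact_mod_cast (WithTop.coe_eq_coe.mp h1).le
    · have h2 := hmarg j _ hw
      rw [h1] at h2
      have h3 : c j + 1 ≤ walkCostFin d g.get (lam j) (seqOf d g q) := WithTop.coe_le_coe.mp h2
      exact_mod_cast (show c j ≤ walkCostFin d g.get (lam j) (seqOf d g q) by omega)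
  have hstrict : ∀ j (q : G.LWalk 0 g.length), q.src = (P j).src → q ≠ P j →
      (P j).icpt + (P j).slope * lam j + 1 ≤ q.icpt + q.slope * lam j := by
    intro j q hq hne'
    rw [hcostP, ← walkCostFin_seqOf d g q (lam j)]
    have hq0 : seqOf d g q 0 = v₀ := by
      have h0 : q.f ⟨0, by omega⟩ = Fintype.equivFin V (y j ⟨0, by omega⟩) := hq
      show (Fintype.equivFin V).symm (q.f ⟨0, by omega⟩) = v₀
      rw [h0, Equiv.symm_apply_apply]
      exact hy0 j
    have h1 := walkCost_ofFn d (lam j) g (seqOf d g q) (edgeAt_seqOf_isSome d g q)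
    rw [hq0] at h1
    have hw : (List.ofFn fun s : Fin g.length => seqOf d g q s.succ) ≠ wstar j := by
      intro hw
      apply hne'
      -- same start and same list of later vertices ⇒ same vertex sequence ⇒ same walk
      have hyy : seqOf d g q = y j := eq_of_ofFn_eq (hq0.trans (hy0 j).symm) (hw.trans (hyw j).symm)
      apply LayeredGraph.LWalk.ext
      funext i
      have := congr_fun hyy i
      simp only [seqOf] at this
      simp only [P, toLWalk]
      rw [← this, Equiv.apply_symm_apply]
    have h2 := hmarg j _ hw
    rw [h1] at h2
    exact_mod_cast WithTop.coe_le_coe.mp h2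
  -- all dedicated walks start at `v₀`
  have hsrc : ∀ j j', (P j).src = (P j').src := by
    intro j j'
    show Fintype.equivFin V (y j ⟨0, by omega⟩) = Fintype.equivFin V (y j' ⟨0, by omega⟩)
    rw [show y j ⟨0, by omega⟩ = v₀ from hy0 j, show y j' ⟨0, by omega⟩ = v₀ from hy0 j']
  -- consecutive dedicated walks are distinct, so slopes strictly decrease
  have hPne : ∀ j : Fin N, P j.castSucc ≠ P j.succ := by
    intro j h
    apply hne j
    rw [← hyw, ← hyw]
    have : y j.castSucc = y j.succ := by rw [← hseqP, ← hseqP, h]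
    rw [this]
  have hanti : StrictAnti fun j => (P j).slope := by
    rw [Fin.strictAnti_iff_succ_lt]
    intro j
    have h1 := hstrict j.castSucc (P j.succ) (hsrc _ _) (hPne j).symm
    have h2 := hstrict j.succ (P j.castSucc) (hsrc _ _) (hPne j)
    have hl : (lam j.castSucc : ℝ) < lam j.succ := by exact_mod_cast hlam Fin.castSucc_lt_succ
    by_contra hcon
    push Not at hcon
    nlinarith
  -- group by end vertex: each group is a chain of `WalkFam`
  have hgroup : ∀ yv : Fin (Fintype.card V),
      (univ.filter fun j => (P j).dst = yv).card ≤ (2 * Fintype.card V) ^ Nat.clog 2 g.length := by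
    intro yv
    set J := univ.filter fun j : Fin (N + 1) => (P j).dst = yv with hJ
    set k := J.card with hk
    rcases Nat.eq_zero_or_pos k with hk0 | hkpos
    · rw [hk0]; exact Nat.zero_le _
    obtain ⟨k', hk'⟩ : ∃ k', k = k' + 1 := ⟨k - 1, by omega⟩
    let e : Fin k ↪o Fin (N + 1) := J.orderEmbOfFin hk.symm
    have heJ : ∀ i, e i ∈ J := fun i => J.orderEmbOfFin_mem hk.symm i
    have hdst : ∀ i, (P (e i)).dst = yv := fun i => (mem_filter.mp (heJ i)).2
    have hch := chainBound_walkFam_clog G 0 g.length (P 0).src yv k'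
      (fun i => (lam (e (Fin.cast hk'.symm i)) : ℝ))
      (fun i => ⟨P (e (Fin.cast hk'.symm i)), hsrc _ _, hdst _⟩)
      (fun i i' hii' => by
        have hlt : e (Fin.cast hk'.symm i) < e (Fin.cast hk'.symm i') :=
          e.strictMono (show Fin.cast hk'.symm i < Fin.cast hk'.symm i' by simpa using hii')
        show (lam (e (Fin.cast hk'.symm i)) : ℝ) < lam (e (Fin.cast hk'.symm i'))
        exact_mod_cast hlam hlt)
      (fun i q => hmin _ q.1 (q.2.1.trans (hsrc _ _)))
      (fun i i' hii' => hanti (e.strictMono (show Fin.cast hk'.symm i < Fin.cast hk'.symm i' by simpa using hii')))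
    omega
  -- sum over the end vertices
  have hsum : N + 1 = ∑ yv : Fin (Fintype.card V), (univ.filter fun j => (P j).dst = yv).card := by
    have h := Finset.card_eq_sum_card_fiberwise (f := fun j => (P j).dst) (s := (univ : Finset (Fin (N + 1))))
      (t := (univ : Finset (Fin (Fintype.card V)))) (fun _ _ => mem_univ _)
    rw [card_univ, Fintype.card_fin] at h
    exact h
  calc N + 1 = ∑ yv : Fin (Fintype.card V), (univ.filter fun j => (P j).dst = yv).card := hsum
    _ ≤ ∑ _yv : Fin (Fintype.card V), (2 * Fintype.card V) ^ Nat.clog 2 g.length := sum_le_sum fun yv _ => hgroup yv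
    _ = Fintype.card V * (2 * Fintype.card V) ^ Nat.clog 2 g.length := by
        rw [sum_const, card_univ, Fintype.card_fin, smul_eq_mul]

/-- **Bounded width.**  The same bound read for a walk system of width `w = |V|` on `T` layers: `N < w · (2w)^⌈log₂ T⌉`; with
`m = (T+1)·w` nodes in `le_of_walkSystem`, this is `O(m^{log₂ 2w})` dedicated walks — quadratic at width `2`, `< m^{2.59}` at
width `3`, cubic at width `4`: a cubic-in-`m` witness for the `K = 4` fork through `le_of_walkSystem` needs width `≥ 4`.
[cite: Gusfield1980, n^{O(log n)} bound for parametric shortest paths (via GajjarRadhakrishnan2019 p. 2); folklore form] -/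
theorem walkSystem_lt [DecidableEq V] (g : List (WLayer V K)) (v₀ : V) {N : ℕ}
    (lam : Fin (N + 1) → ℤ) (hlam : StrictMono lam) (wstar : Fin (N + 1) → List V) (c : Fin (N + 1) → ℤ)
    (hcost : ∀ j, walkCost d (lam j) g v₀ (wstar j) = ((c j : ℤ) : WithTop ℤ))
    (hmarg : ∀ j (w : List V), w ≠ wstar j → ((c j + 1 : ℤ) : WithTop ℤ) ≤ walkCost d (lam j) g v₀ w)
    (hne : ∀ j : Fin N, wstar j.castSucc ≠ wstar j.succ) :
    N < Fintype.card V * (2 * Fintype.card V) ^ Nat.clog 2 g.length :=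
  walkSystem_succ_le d g v₀ lam hlam wstar c hcost hmarg hne

end Summit.ValiantsHypothesis.ValiantsHypothesis.Theorems.KPlusLogSqLaw.WalkDesign
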